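import Mathlib
import HarnessLib
import Summits.Ventures.LatticeQCDFlow.Exactness.NCMCGeneralSpaceAcceptanceChernoff
import Summits.Ventures.LatticeQCDFlow.Exactness.NCMCGeneralSpaceAcceptanceCLT

/-!
# Bennett's inequality with the true variance for the reported acceptance on a general state space

HONEST FRAMING: exact (Metropolis-corrected) sampling algorithms for lattice gauge theory;
figures of merit are autocorrelation/cost numbers at stated couplings and volumes; no
continuum-physics claim.

Venture `LatticeQCDFlow` (cell pub-lqcd), topic `Exactness`; FANOUT row 13 (`eng-snf`, GEN-14).
NEW WORK of the cell (elementary: one calculus lemma, Mathlib's Chernoff bound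
`measure_ge_le_exp_mul_mgf`, the product rule `iIndepFun.mgf_sum₀`), not a published result; nothing
is cited as a fact (G. Bennett 1962, S. Bernstein 1924 named only).  Continuation of
`NCMCGeneralSpaceAcceptanceChernoff.lean` (GEN-13), whose NOT-TYPED list named "Bennett's inequality
with the true variance": those bounds are the `[0,1]`-Chernoff family, sensitive to the spread of the
acceptance probability `α = min(1, e^{−(W−c)})` only through its mean `a_F(c)`.  The engine reports
the MEAN ACCEPTANCE PROBABILITY of its switch proposals (a Rao–Blackwellised figure, not only the
accept/reject count); its fluctuations are governed by `σ² = Var_F[α] ≤ a_F(1 − a_F)` (GEN-13's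
`CrooksPair.variance_accept_le`), MUCH smaller for a nearly dissipation-free protocol, where `α`
concentrates.  Bennett-to-Bernstein is GEN-13's `sq_div_le_bennettExponent`, reused.

## Setting and content

`μ` a probability law on records, `g : E → [0,1]` measurable with mean `a = E_μ g`, `N ≥ 1` i.i.d.
records `Measure.pi (fun _ : Fin N => μ)`, `X̄ = sampleMean g`, `t > 0`, and a VARIANCE PROXY
`v > 0` with `Var_μ[g] ≤ v` (the true variance when it is positive; `a(1 − a)`; `1/4`).

* `hasDerivAt_bennettAux`, **`exp_mul_sub_le_mul_sq`** — THE CALCULUS LEMMA: for `y ≤ 1`, `λ ≥ 0`,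
  `e^{λy} − 1 − λy ≤ (e^{λ} − 1 − λ) y²` (`(e^{λ} − 1 − λ)y² − (e^{λy} − 1 − λy)` vanishes at `λ = 0`
  and is non-decreasing in `λ`: its derivative `y((e^{λ} − 1)y − (e^{λy} − 1))` is `≥ 0` by the
  chord inequality for `0 ≤ y ≤ 1` and by `e^{x} ≥ 1 + x` twice for `y < 0`).
* **`mgf_sub_mean_le_exp_variance`** — BENNETT'S MGF BOUND `E_μ e^{λ(g − a)} ≤ exp(Var_μ[g](e^{λ} − 1 − λ))`.
* **`measureReal_sampleMean_sub_ge_le_exp_bennett_of_variance_le`** — BENNETT'S INEQUALITY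
  `μ^{⊗N}{X̄ − a ≥ t} ≤ exp(−N[(v + t) log(1 + t/v) − t])`; **`…_bernstein_of_variance_le`** —
  BERNSTEIN `≤ exp(−N t²/(2(v + t/3)))`; **`measureReal_sub_sampleMean_ge_le_exp_bernstein_of_variance_le`**
  — the lower tail (`Var_μ[1 − g] = Var_μ[g]`); **`measureReal_sampleMean_sub_ge_le_exp_bernstein_bernoulli`**
  — the hypothesis-free proxy `v = a(1 − a)` (for `a ∈ {0, 1}`, `g` is a.s. constant, the event null).
* For a Crooks pair `(κF, κR, s, e, W)` from `ν₀` to `ν₁`, a level constant `c`, `N` independent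
  forward evolutions and `σ² = Var_F[min(1, e^{−(W−c)})]`:
  **`CrooksPair.measureReal_sampleMean_accept_sub_ge_le_exp_of_variance_le`** /
  **`CrooksPair.measureReal_accept_sub_sampleMean_ge_le_exp_of_variance_le`** (both Bernstein tails
  with any proxy `v ≥ σ²`, `v > 0`), **`CrooksPair.measureReal_sampleMean_accept_sub_ge_le_exp_bernoulli`**
  (`v = a_F(1 − a_F)`, no hypothesis), **`CrooksPair.measureReal_abs_sampleMean_accept_sub_ge_le_of_variance_le`**
  — TWO-SIDED: `P{|ᾱ_N − a_F(c)| ≥ t} ≤ 2 exp(−N t²/(2(v + t/3)))`.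
  Reading for the engine (boarded `acceptance` = mean of `min(1, e^{−(W_i − c)})`, planted-control
  checks, `ncmc.c` pilots): the `1 − δ` confidence radius of the reported acceptance after `N`
  independent proposals is `≤ √(2 v log(2/δ)/N) + (2/3) log(2/δ)/N` with `v` the VARIANCE of the
  acceptance probability — for a nearly quasi-static protocol far inside both Hoeffding's
  `√(log(2/δ)/(2N))` and the count-based `√(2 a_F(1 − a_F) log(2/δ)/N)`.

Scope / NOT CLAIMED: independent evolutions only; `v` is an INPUT (a bound on `Var_F[α]`; the true
variance is not estimated here — a plug-in sample variance is NOT covered); no value for any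
concrete protocol; Bennett's exponent is not claimed optimal.
-/

namespace Summit.Ventures.LatticeQCDFlow.Exactness.GeneralNCMC

open MeasureTheory ProbabilityTheory Set Filter Finset
open scoped ENNReal NNReal Topology

variable {E : Type*} [MeasurableSpace E]

/-! ## The calculus lemma behind Bennett's inequality -/

/-- The Bennett auxiliary `k(u) = (e^{u} − 1 − u) y² − (e^{uy} − 1 − uy)` has derivative
`y((e^{u} − 1) y − (e^{uy} − 1))`. -/
theorem hasDerivAt_bennettAux (y x : ℝ) :
    HasDerivAt (fun u => (Real.exp u - 1 - u) * y ^ 2 - (Real.exp (u * y) - 1 - u * y))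
      (y * ((Real.exp x - 1) * y - (Real.exp (x * y) - 1))) x := by
  have h1 : HasDerivAt (fun u => (Real.exp u - 1 - u) * y ^ 2) ((Real.exp x - 1) * y ^ 2) x :=
    (((Real.hasDerivAt_exp x).sub_const 1).fun_sub (hasDerivAt_id' x)).mul_const _
  have hl : HasDerivAt (fun u : ℝ => u * y) (1 * y) x := (hasDerivAt_id' x).mul_const y
  have he : HasDerivAt (fun u : ℝ => Real.exp (u * y)) (Real.exp (x * y) * (1 * y)) x := hl.exp
  have h2 : HasDerivAt (fun u => Real.exp (u * y) - 1 - u * y) (Real.exp (x * y) * (1 * y) - 1 * y) x :=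
    (he.sub_const 1).fun_sub hl
  refine (h1.fun_sub h2).congr_deriv ?_
  ring

/-- **The calculus lemma**: for `y ≤ 1` and `λ ≥ 0`, `e^{λy} − 1 − λy ≤ (e^{λ} − 1 − λ) y²`
(the function `(e^{x} − 1 − x)/x²` is non-decreasing; proved through monotonicity in `λ`). -/
theorem exp_mul_sub_le_mul_sq {y : ℝ} (hy : y ≤ 1) {t : ℝ} (ht : 0 ≤ t) :
    Real.exp (t * y) - 1 - t * y ≤ (Real.exp t - 1 - t) * y ^ 2 := by
  set k : ℝ → ℝ := fun u => (Real.exp u - 1 - u) * y ^ 2 - (Real.exp (u * y) - 1 - u * y) with hk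
  have hder : ∀ x, HasDerivAt k (y * ((Real.exp x - 1) * y - (Real.exp (x * y) - 1))) x :=
    fun x => hasDerivAt_bennettAux y x
  -- the derivative is `≥ 0` on `[0, ∞)`: chord inequality for `0 ≤ y ≤ 1`, else `(eˣ − 1)y ≤ xy ≤ e^{xy} − 1`
  have hnonneg : ∀ x : ℝ, 0 ≤ x → 0 ≤ y * ((Real.exp x - 1) * y - (Real.exp (x * y) - 1)) := by
    intro x hx
    rcases le_or_gt 0 y with hy0 | hy0
    · have hc := exp_mul_le_of_mem_Icc ⟨hy0, hy⟩ x
      exact mul_nonneg hy0 (by linarith)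
    · have h1 : (Real.exp x - 1) * y ≤ x * y :=
        mul_le_mul_of_nonpos_right (by linarith [Real.add_one_le_exp x]) hy0.le
      have h2 : x * y ≤ Real.exp (x * y) - 1 := by linarith [Real.add_one_le_exp (x * y)]
      exact mul_nonneg_of_nonpos_of_nonpos hy0.le (by linarith)
  have hmono : MonotoneOn k (Ici 0) := by
    refine monotoneOn_of_hasDerivWithinAt_nonneg (convex_Ici 0) (f := k)
      (f' := fun x => y * ((Real.exp x - 1) * y - (Real.exp (x * y) - 1))) ?_ ?_ ?_
    · exact fun x _ => (hder x).continuousAt.continuousWithinAt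
    · exact fun x _ => (hder x).hasDerivWithinAt
    · intro x hx
      rw [interior_Ici] at hx
      exact hnonneg x (le_of_lt hx)
  have key : k 0 ≤ k t := hmono (Set.mem_Ici.2 le_rfl) (Set.mem_Ici.2 ht) ht
  simp only [hk, Real.exp_zero, zero_mul, sub_self] at key
  linarith

section IID

variable (μ : Measure E) [IsProbabilityMeasure μ]

/-! ## Bennett's bound on the moment generating function of the centred observable -/

/-- **Bennett's MGF bound**: for a measurable `g : E → [0,1]` with mean `a = E_μ g` and `λ ≥ 0`,
`E_μ e^{λ(g − a)} ≤ exp(Var_μ[g] (e^{λ} − 1 − λ))` (`g − a ≤ 1`, the calculus lemma pointwise,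
`E(g − a) = 0`, `E(g − a)² = Var`, then `1 + x ≤ e^{x}`). -/
theorem mgf_sub_mean_le_exp_variance {g : E → ℝ} (hg : Measurable g)
    (h01 : ∀ x, g x ∈ Icc (0 : ℝ) 1) {t : ℝ} (ht : 0 ≤ t) :
    mgf (fun x => g x - ∫ a, g a ∂μ) μ t ≤ Real.exp (Var[g; μ] * (Real.exp t - 1 - t)) := by
  set a := ∫ x, g x ∂μ with hadef
  have hL2 := memLp_two_of_mem_Icc μ hg h01
  have hint : Integrable g μ := hL2.integrable one_le_two
  have ha0 : 0 ≤ a := integral_nonneg fun x => (h01 x).1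
  have hya : ∀ x, g x - a ≤ 1 := fun x => by linarith [(h01 x).2]
  have hcint : Integrable (fun x => g x - a) μ := hint.sub (integrable_const a)
  have hsqint : Integrable (fun x => (g x - a) ^ 2) μ := (hL2.sub (memLp_const a)).integrable_sq
  have hexpint : Integrable (fun x => Real.exp (t * (g x - a))) μ := by
    refine Integrable.of_bound (Real.measurable_exp.comp ((hg.sub_const a).const_mul t)).aestronglyMeasurable
      (Real.exp t) (Eventually.of_forall fun x => ?_)
    rw [Real.norm_eq_abs, abs_of_nonneg (Real.exp_pos _).le, Real.exp_le_exp]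
    nlinarith [hya x]
  have hmean : ∫ x, (g x - a) ∂μ = 0 := by
    rw [integral_sub hint (integrable_const a), integral_const, smul_eq_mul, probReal_univ, one_mul,
      hadef, sub_self]
  have hvar : ∫ x, (g x - a) ^ 2 ∂μ = Var[g; μ] := by
    rw [variance_eq_integral hg.aemeasurable]
  have hlin : Integrable (fun x => 1 + t * (g x - a)) μ := (integrable_const 1).add (hcint.const_mul t)
  calc mgf (fun x => g x - a) μ t = ∫ x, Real.exp (t * (g x - a)) ∂μ := rfl
    _ ≤ ∫ x, (1 + t * (g x - a) + (Real.exp t - 1 - t) * (g x - a) ^ 2) ∂μ :=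
        integral_mono hexpint (hlin.add (hsqint.const_mul _)) fun x => by
          have := exp_mul_sub_le_mul_sq (hya x) ht
          linarith
    _ = 1 + (Real.exp t - 1 - t) * Var[g; μ] := by
        rw [integral_add hlin (hsqint.const_mul _), integral_add (integrable_const 1) (hcint.const_mul t),
          integral_const, smul_eq_mul, probReal_univ, one_mul, integral_const_mul, hmean, mul_zero,
          add_zero, integral_const_mul, hvar]
    _ ≤ Real.exp (Var[g; μ] * (Real.exp t - 1 - t)) := by
        linarith [Real.add_one_le_exp (Var[g; μ] * (Real.exp t - 1 - t))]

/-! ## Bennett's and Bernstein's inequalities for the sample mean of `N` i.i.d. records -/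

/-- **Bennett's inequality.**  For a measurable `g : E → [0,1]` with mean `a`, a variance proxy
`v > 0` with `Var_μ[g] ≤ v`, `N ≥ 1` i.i.d. records and `t > 0`,
`μ^{⊗N} {(1/N) Σ_i g(y i) − a ≥ t} ≤ exp(−N[(v + t) log(1 + t/v) − t])`
(Chernoff at `λ = log(1 + t/v)` on the centred sum, independence, the MGF bound). -/
theorem measureReal_sampleMean_sub_ge_le_exp_bennett_of_variance_le {g : E → ℝ} (hg : Measurable g)
    (h01 : ∀ a, g a ∈ Icc (0 : ℝ) 1) {N : ℕ} (hN : 0 < N) {t : ℝ} (ht : 0 < t) {v : ℝ}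
    (hv0 : 0 < v) (hv : Var[g; μ] ≤ v) :
    (Measure.pi fun _ : Fin N => μ).real {y | t ≤ sampleMean g y - ∫ a, g a ∂μ} ≤
      Real.exp (-(N * ((v + t) * Real.log (1 + t / v) - t))) := by
  set P := Measure.pi fun _ : Fin N => μ with hP
  set a := ∫ x, g x ∂μ with hadef
  set l := Real.log (1 + t / v) with hl
  have hv' : v ≠ 0 := hv0.ne'
  have hl0 : 0 < l := Real.log_pos (by rw [lt_add_iff_pos_right]; positivity)
  have hexpl : Real.exp l = 1 + t / v := Real.exp_log (by positivity)
  -- independence of the centred coordinates and the one-coordinate MGF bound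
  have hcm : Measurable fun x => g x - a := hg.sub_const a
  have hindep : iIndepFun (fun (i : Fin N) (y : Fin N → E) => g (y i) - a) P :=
    iIndepFun_pi (μ := fun _ : Fin N => μ) (X := fun _ : Fin N => fun x => g x - a)
      fun _ => hcm.aemeasurable
  have hmgf_i : ∀ i : Fin N,
      mgf (fun y : Fin N → E => g (y i) - a) P l ≤ Real.exp (v * (Real.exp l - 1 - l)) := by
    intro i
    have hid : mgf (fun y : Fin N → E => g (y i) - a) P l = mgf (fun x => g x - a) μ l :=
      integral_comp_eval_pi μ i (Real.measurable_exp.comp (hcm.const_mul l)).aestronglyMeasurable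
    rw [hid]
    refine (mgf_sub_mean_le_exp_variance μ hg h01 hl0.le).trans ?_
    rw [Real.exp_le_exp]
    exact mul_le_mul_of_nonneg_right hv (by linarith [Real.add_one_le_exp l])
  have hsum : (∑ i : Fin N, fun y : Fin N → E => g (y i) - a) = fun y => ∑ i, (g (y i) - a) := by
    funext y
    rw [Finset.sum_apply]
  have hmgf : mgf (fun y : Fin N → E => ∑ i, (g (y i) - a)) P l ≤
      Real.exp (N * (v * (Real.exp l - 1 - l))) := by
    rw [← hsum, hindep.mgf_sum₀ (fun i => (hcm.comp (measurable_pi_apply i)).aemeasurable) univ]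
    calc ∏ i, mgf (fun y : Fin N → E => g (y i) - a) P l
        ≤ ∏ _i : Fin N, Real.exp (v * (Real.exp l - 1 - l)) :=
          Finset.prod_le_prod (fun i _ => mgf_nonneg) fun i _ => hmgf_i i
      _ = Real.exp (N * (v * (Real.exp l - 1 - l))) := by
          rw [Finset.prod_const, card_univ, Fintype.card_fin, ← Real.exp_nat_mul]
  -- integrability of `e^{l S}` (the centred sum is at most `N`)
  have hSm : Measurable fun y : Fin N → E => ∑ i, (g (y i) - a) :=
    Finset.measurable_sum _ fun i _ => hcm.comp (measurable_pi_apply i)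
  have ha0 : 0 ≤ a := integral_nonneg fun x => (h01 x).1
  have hSint : Integrable (fun y : Fin N → E => Real.exp (l * ∑ i, (g (y i) - a))) P := by
    refine Integrable.of_bound (Real.measurable_exp.comp (hSm.const_mul l)).aestronglyMeasurable
      (Real.exp (l * N)) (Eventually.of_forall fun y => ?_)
    rw [Real.norm_eq_abs, abs_of_nonneg (Real.exp_pos _).le, Real.exp_le_exp]
    refine mul_le_mul_of_nonneg_left ?_ hl0.le
    calc ∑ i, (g (y i) - a) ≤ ∑ _i : Fin N, (1 : ℝ) :=
          Finset.sum_le_sum fun i _ => by linarith [(h01 (y i)).2]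
      _ = N := by rw [Finset.sum_const, card_univ, Fintype.card_fin, nsmul_eq_mul, mul_one]
  -- Chernoff
  have hcher := measure_ge_le_exp_mul_mgf (μ := P) (X := fun y : Fin N → E => ∑ i, (g (y i) - a))
    (N * t) hl0.le hSint
  have hNpos : (0 : ℝ) < N := by exact_mod_cast hN
  have hset : {y : Fin N → E | t ≤ sampleMean g y - a} = {y | (N : ℝ) * t ≤ ∑ i, (g (y i) - a)} := by
    ext y
    simp only [mem_setOf_eq, sampleMean, Finset.sum_sub_distrib, Finset.sum_const, card_univ,
      Fintype.card_fin, nsmul_eq_mul, le_sub_iff_add_le]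
    rw [le_div_iff₀ hNpos]
    constructor <;> intro h <;> linarith
  rw [hset]
  refine hcher.trans ?_
  calc Real.exp (-l * (N * t)) * mgf (fun y : Fin N → E => ∑ i, (g (y i) - a)) P l
      ≤ Real.exp (-l * (N * t)) * Real.exp (N * (v * (Real.exp l - 1 - l))) :=
        mul_le_mul_of_nonneg_left hmgf (Real.exp_pos _).le
    _ = Real.exp (-(N * ((v + t) * Real.log (1 + t / v) - t))) := by
        rw [← Real.exp_add, hexpl, ← hl]
        congr 1
        field_simp
        ring

/-- **Bernstein's inequality** (variance form): under the same hypotheses,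
`μ^{⊗N} {(1/N) Σ_i g(y i) − a ≥ t} ≤ exp(−N t²/(2(v + t/3)))`. -/
theorem measureReal_sampleMean_sub_ge_le_exp_bernstein_of_variance_le {g : E → ℝ}
    (hg : Measurable g) (h01 : ∀ a, g a ∈ Icc (0 : ℝ) 1) {N : ℕ} (hN : 0 < N) {t : ℝ} (ht : 0 < t)
    {v : ℝ} (hv0 : 0 < v) (hv : Var[g; μ] ≤ v) :
    (Measure.pi fun _ : Fin N => μ).real {y | t ≤ sampleMean g y - ∫ a, g a ∂μ} ≤
      Real.exp (-(N * t ^ 2 / (2 * (v + t / 3)))) := by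
  refine (measureReal_sampleMean_sub_ge_le_exp_bennett_of_variance_le μ hg h01 hN ht hv0 hv).trans ?_
  rw [Real.exp_le_exp, neg_le_neg_iff, mul_div_assoc]
  exact mul_le_mul_of_nonneg_left (sq_div_le_bennettExponent hv0 ht.le) (Nat.cast_nonneg N)

/-- **Bernstein's inequality, lower tail**: `μ^{⊗N} {a − (1/N) Σ_i g(y i) ≥ t} ≤ exp(−N t²/(2(v + t/3)))`
(the upper tail of `1 − g`, which has the same variance). -/
theorem measureReal_sub_sampleMean_ge_le_exp_bernstein_of_variance_le {g : E → ℝ}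
    (hg : Measurable g) (h01 : ∀ a, g a ∈ Icc (0 : ℝ) 1) {N : ℕ} (hN : 0 < N) {t : ℝ} (ht : 0 < t)
    {v : ℝ} (hv0 : 0 < v) (hv : Var[g; μ] ≤ v) :
    (Measure.pi fun _ : Fin N => μ).real {y | t ≤ (∫ a, g a ∂μ) - sampleMean g y} ≤
      Real.exp (-(N * t ^ 2 / (2 * (v + t / 3)))) := by
  have h01' : ∀ a, 1 - g a ∈ Icc (0 : ℝ) 1 := fun a =>
    ⟨by linarith [(h01 a).2], by linarith [(h01 a).1]⟩
  have hv' : Var[fun a => 1 - g a; μ] ≤ v := by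
    rw [variance_const_sub hg.aestronglyMeasurable 1]
    exact hv
  have h := measureReal_sampleMean_sub_ge_le_exp_bernstein_of_variance_le μ (g := fun a => 1 - g a)
    (measurable_const.sub hg) h01' hN ht hv0 hv'
  have hint : ∫ a, (1 - g a) ∂μ = 1 - ∫ a, g a ∂μ := by
    rw [integral_sub (integrable_const 1) (Integrable.of_mem_Icc 0 1 hg.aemeasurable
      (Eventually.of_forall h01)), integral_const, smul_eq_mul, probReal_univ, one_mul]
  have hN' : (N : ℝ) ≠ 0 := by exact_mod_cast hN.ne'
  have hsm : ∀ y : Fin N → E, sampleMean (fun a => 1 - g a) y = 1 - sampleMean g y := fun y => by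
    unfold sampleMean
    rw [sum_sub_distrib, sum_const, card_univ, Fintype.card_fin, nsmul_eq_mul, mul_one]
    field_simp
  have hset : {y : Fin N → E | t ≤ sampleMean (fun a => 1 - g a) y - ∫ a, (1 - g a) ∂μ} =
      {y | t ≤ (∫ a, g a ∂μ) - sampleMean g y} := by
    ext y
    simp only [mem_setOf_eq, hsm y, hint]
    constructor <;> intro h <;> linarith
  rw [hset] at h
  exact h

/-- **Bernstein with the Bernoulli proxy `v = a(1 − a)`, hypothesis-free**:
`μ^{⊗N} {(1/N) Σ_i g(y i) − a ≥ t} ≤ exp(−N t²/(2(a(1 − a) + t/3)))` (`Var_μ[g] ≤ a(1 − a)`,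
GEN-13's `variance_le_mean_mul_one_sub_mean`; if `a(1 − a) = 0` then `g` is a.s. constant and the
event is null).  Sharper than GEN-13's `[0,1]`-Chernoff form, which has `a` in place of `a(1 − a)`. -/
theorem measureReal_sampleMean_sub_ge_le_exp_bernstein_bernoulli {g : E → ℝ} (hg : Measurable g)
    (h01 : ∀ a, g a ∈ Icc (0 : ℝ) 1) {N : ℕ} (hN : 0 < N) {t : ℝ} (ht : 0 < t) :
    (Measure.pi fun _ : Fin N => μ).real {y | t ≤ sampleMean g y - ∫ a, g a ∂μ} ≤
      Real.exp (-(N * t ^ 2 / (2 * ((∫ a, g a ∂μ) * (1 - ∫ a, g a ∂μ) + t / 3)))) := by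
  set P := Measure.pi fun _ : Fin N => μ with hP
  set a := ∫ x, g x ∂μ with hadef
  rcases lt_or_ge 0 (a * (1 - a)) with hpos | hle
  · exact measureReal_sampleMean_sub_ge_le_exp_bernstein_of_variance_le μ hg h01 hN ht hpos
      (variance_le_mean_mul_one_sub_mean μ hg h01)
  · -- degenerate case: `Var g = 0`, `g = a` a.s., the sample mean is a.s. `a`
    have hL2 := memLp_two_of_mem_Icc μ hg h01
    have hvar0 : Var[g; μ] = 0 :=
      le_antisymm ((variance_le_mean_mul_one_sub_mean μ hg h01).trans hle) (variance_nonneg g μ)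
    have hae : g =ᵐ[μ] fun _ => a := ae_eq_integral_of_variance_eq_zero hL2 hvar0
    have hall : ∀ᵐ y ∂P, ∀ i : Fin N, g (y i) = a := by
      rw [ae_all_iff]
      intro i
      exact (measurePreserving_eval (fun _ : Fin N => μ) i).quasiMeasurePreserving.ae_eq_comp hae
    have hNpos : (0 : ℝ) < N := by exact_mod_cast hN
    have hnull : P.real {y | t ≤ sampleMean g y - a} = 0 := by
      rw [measureReal_def, ENNReal.toReal_eq_zero_iff]
      left
      refine measure_eq_zero_iff_ae_notMem.2 (hall.mono fun y hy hmem => ?_)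
      simp only [mem_setOf_eq, sampleMean, hy, Finset.sum_const, card_univ, Fintype.card_fin,
        nsmul_eq_mul] at hmem
      rw [mul_div_cancel_left₀ a hNpos.ne'] at hmem
      linarith
    rw [hnull]
    exact (Real.exp_pos _).le

end IID

/-! ## For a Crooks pair: confidence radii for the reported mean acceptance scale with `Var_F[α]` -/

namespace CrooksPair

variable {Ω : Type*} [MeasurableSpace Ω]
variable {ν₀ ν₁ : Measure Ω} {κF κR : Kernel Ω E} {s e : E → Ω} {W : E → ℝ}

/-- **Bernstein upper tail for the reported acceptance, variance form.**  For every Crooks pair,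
every level constant `c`, `N ≥ 1` independent forward evolutions from prior equilibrium, `t > 0`
and every `v > 0` with `Var_F[min(1, e^{−(W−c)})] ≤ v`: the mean of the `N` acceptance
probabilities exceeds `a_F(c) + t` with probability at most `exp(−N t²/(2(v + t/3)))`. -/
theorem measureReal_sampleMean_accept_sub_ge_le_exp_of_variance_le [IsFiniteMeasure ν₀]
    [IsMarkovKernel κF] (h0 : ν₀ univ ≠ 0) (h : CrooksPair ν₀ ν₁ κF κR s e W) (c : ℝ) {N : ℕ}
    (hN : 0 < N) {t : ℝ} (ht : 0 < t) {v : ℝ} (hv0 : 0 < v)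
    (hv : Var[fun ε => min 1 (Real.exp (-(W ε - c))); fwdPathLaw ν₀ κF] ≤ v) :
    haveI := isProbabilityMeasure_fwdPathLaw ν₀ h0 κF
    (Measure.pi fun _ : Fin N => fwdPathLaw ν₀ κF).real
        {y | t ≤ sampleMean (fun ε => min 1 (Real.exp (-(W ε - c)))) y -
          ∫ ε, min 1 (Real.exp (-(W ε - c))) ∂(fwdPathLaw ν₀ κF)} ≤
      Real.exp (-(N * t ^ 2 / (2 * (v + t / 3)))) := by
  haveI := isProbabilityMeasure_fwdPathLaw ν₀ h0 κF
  exact measureReal_sampleMean_sub_ge_le_exp_bernstein_of_variance_le (fwdPathLaw ν₀ κF)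
    (measurable_accept_mem_Icc h.measurable_W c).1 (measurable_accept_mem_Icc h.measurable_W c).2
    hN ht hv0 hv

/-- **Bernstein lower tail for the reported acceptance, variance form**: the mean acceptance falls
below `a_F(c) − t` with probability at most `exp(−N t²/(2(v + t/3)))`. -/
theorem measureReal_accept_sub_sampleMean_ge_le_exp_of_variance_le [IsFiniteMeasure ν₀]
    [IsMarkovKernel κF] (h0 : ν₀ univ ≠ 0) (h : CrooksPair ν₀ ν₁ κF κR s e W) (c : ℝ) {N : ℕ}
    (hN : 0 < N) {t : ℝ} (ht : 0 < t) {v : ℝ} (hv0 : 0 < v)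
    (hv : Var[fun ε => min 1 (Real.exp (-(W ε - c))); fwdPathLaw ν₀ κF] ≤ v) :
    haveI := isProbabilityMeasure_fwdPathLaw ν₀ h0 κF
    (Measure.pi fun _ : Fin N => fwdPathLaw ν₀ κF).real
        {y | t ≤ (∫ ε, min 1 (Real.exp (-(W ε - c))) ∂(fwdPathLaw ν₀ κF)) -
          sampleMean (fun ε => min 1 (Real.exp (-(W ε - c)))) y} ≤
      Real.exp (-(N * t ^ 2 / (2 * (v + t / 3)))) := by
  haveI := isProbabilityMeasure_fwdPathLaw ν₀ h0 κF
  exact measureReal_sub_sampleMean_ge_le_exp_bernstein_of_variance_le (fwdPathLaw ν₀ κF)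
    (measurable_accept_mem_Icc h.measurable_W c).1 (measurable_accept_mem_Icc h.measurable_W c).2
    hN ht hv0 hv

/-- **Two-sided form**: `P{|ᾱ_N − a_F(c)| ≥ t} ≤ 2 exp(−N t²/(2(v + t/3)))` for every variance
proxy `v ≥ Var_F[min(1, e^{−(W−c)})]`, `v > 0`. -/
theorem measureReal_abs_sampleMean_accept_sub_ge_le_of_variance_le [IsFiniteMeasure ν₀] [IsMarkovKernel κF]
    (h0 : ν₀ univ ≠ 0) (h : CrooksPair ν₀ ν₁ κF κR s e W) (c : ℝ) {N : ℕ} (hN : 0 < N) {t : ℝ}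
    (ht : 0 < t) {v : ℝ} (hv0 : 0 < v)
    (hv : Var[fun ε => min 1 (Real.exp (-(W ε - c))); fwdPathLaw ν₀ κF] ≤ v) :
    haveI := isProbabilityMeasure_fwdPathLaw ν₀ h0 κF
    (Measure.pi fun _ : Fin N => fwdPathLaw ν₀ κF).real
        {y | t ≤ |sampleMean (fun ε => min 1 (Real.exp (-(W ε - c)))) y -
          ∫ ε, min 1 (Real.exp (-(W ε - c))) ∂(fwdPathLaw ν₀ κF)|} ≤
      2 * Real.exp (-(N * t ^ 2 / (2 * (v + t / 3)))) := by
  haveI := isProbabilityMeasure_fwdPathLaw ν₀ h0 κF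
  set P := Measure.pi fun _ : Fin N => fwdPathLaw ν₀ κF with hP
  set a := ∫ ε, min 1 (Real.exp (-(W ε - c))) ∂(fwdPathLaw ν₀ κF) with hadef
  set X : (Fin N → E) → ℝ := fun y => sampleMean (fun ε => min 1 (Real.exp (-(W ε - c)))) y with hX
  have hup := h.measureReal_sampleMean_accept_sub_ge_le_exp_of_variance_le h0 c hN ht hv0 hv
  have hlo := h.measureReal_accept_sub_sampleMean_ge_le_exp_of_variance_le h0 c hN ht hv0 hv
  have hsub : {y : Fin N → E | t ≤ |X y - a|} ⊆ {y | t ≤ X y - a} ∪ {y | t ≤ a - X y} := by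
    intro y hy
    simp only [mem_setOf_eq, mem_union] at hy ⊢
    rcases le_abs'.1 hy with h' | h'
    · exact Or.inr (by linarith)
    · exact Or.inl h'
  calc P.real {y | t ≤ |X y - a|} ≤ P.real ({y | t ≤ X y - a} ∪ {y | t ≤ a - X y}) :=
        measureReal_mono hsub
    _ ≤ P.real {y | t ≤ X y - a} + P.real {y | t ≤ a - X y} := measureReal_union_le _ _
    _ ≤ Real.exp (-(N * t ^ 2 / (2 * (v + t / 3)))) + Real.exp (-(N * t ^ 2 / (2 * (v + t / 3)))) :=
        add_le_add hup hlo
    _ = 2 * Real.exp (-(N * t ^ 2 / (2 * (v + t / 3)))) := by ring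

/-- **Bernstein with the Bernoulli proxy, hypothesis-free**: for every Crooks pair, level constant,
`N ≥ 1` and `t > 0`, `P{ᾱ_N − a_F(c) ≥ t} ≤ exp(−N t²/(2(a_F(c)(1 − a_F(c)) + t/3)))`
(`Var_F[α] ≤ a_F(1 − a_F)`, GEN-13's `variance_accept_le`). -/
theorem measureReal_sampleMean_accept_sub_ge_le_exp_bernoulli [IsFiniteMeasure ν₀]
    [IsMarkovKernel κF] (h0 : ν₀ univ ≠ 0) (h : CrooksPair ν₀ ν₁ κF κR s e W) (c : ℝ) {N : ℕ}
    (hN : 0 < N) {t : ℝ} (ht : 0 < t) :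
    haveI := isProbabilityMeasure_fwdPathLaw ν₀ h0 κF
    (Measure.pi fun _ : Fin N => fwdPathLaw ν₀ κF).real
        {y | t ≤ sampleMean (fun ε => min 1 (Real.exp (-(W ε - c)))) y -
          ∫ ε, min 1 (Real.exp (-(W ε - c))) ∂(fwdPathLaw ν₀ κF)} ≤
      Real.exp (-(N * t ^ 2 / (2 * ((∫ ε, min 1 (Real.exp (-(W ε - c))) ∂(fwdPathLaw ν₀ κF)) *
        (1 - ∫ ε, min 1 (Real.exp (-(W ε - c))) ∂(fwdPathLaw ν₀ κF)) + t / 3)))) := by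
  haveI := isProbabilityMeasure_fwdPathLaw ν₀ h0 κF
  exact measureReal_sampleMean_sub_ge_le_exp_bernstein_bernoulli (fwdPathLaw ν₀ κF)
    (measurable_accept_mem_Icc h.measurable_W c).1 (measurable_accept_mem_Icc h.measurable_W c).2
    hN ht

end CrooksPair

end Summit.Ventures.LatticeQCDFlow.Exactness.GeneralNCMC
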